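import Summits.CriticalPhenomena.PercolationContinuityZ3.Theorems.Transplant.SkelPhiCorridorKGRoute
import HarnessLib

/-!
# N2 (frames-only node `SamePDropOfSkeletonFrm₁`, OPEN), (C)/(R) columns: THE SHARP ALONG LOWER BOUND OF EVERY REGION OF THE K-G CORRIDOR —
# `Skelφ.kgCorrSched_region_fst_lower`: `y ∈ region k ⟹ −(q + R′ + n) ≤ y 0`

The prism box of `mem_kgCorrSched_prism_cases` (SkelPhiCorridorKGPrism) reaches back `q + (N+1)R′ + n` along the run axis (the `RunPrm` prism is one box for
all run steps); the REGIONS reach back only `q + R′ + n`: region `k` of the run phase has back edge `k(n − R′) − q − R′ − n` (`RunPrm.aLo`, `La := n`),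
and the two parking phases sit `(N+1)n − O(q + (N+1)R′ + (m₁+1)g)` ahead (`ParkPrm.bLo`, `aBot_le_aLo`). This is the seed-clearance bound the ROOT leg's
`hclear₂` needs under ruling (R-37) (p3-g16 2026-08-23T04:47:07Z: origin shift, `(R-F2′) B.core1Lo 0 ≥ Rs + nL + R'0 + e + 1`), for `k ≥ 0` uniformly, under
one mild row `q + (N+1)R′ + (m₁+1)(R′+ρ+|v|) + n ≤ (N+1)n`.
builds on p205010 (kernel theorem, internal audit signed; external expert review pending) — nothing in this file uses p205010; nothing here is a
claim about the open node `SamePDropOfSkeletonFrm₁`.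
Lane `prim-bschramm`, seat `prim-bschramm-p5` (gen 16; (C) lineage); helper file (`--supports stmt-CriticalPhenomena-4575 --as helper`).
[cite: KozmaNitzan2024, §4 Lemma 11 (p. 22: the slabs of Ω), Lemma 12 (pp. 23–25)] [cite: MartineauTassion2017, §4.3 Lemma 4.2]
-/

noncomputable section

open scoped Classical

namespace Summit.CriticalPhenomena.PercolationContinuityZ3.Theorems.Transplant

namespace Skelφ

open Literature.Probability.Percolation Literature.Probability.LatticeModels SimpleGraph
open Literature.Probability.Percolation.KozmaNitzan.Cells (oth)
open ChainPlanar ChainPara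

variable {V : Type}

section KG

variable {n ℓ : ℕ} {h v : ℤ} {R' ρ q W N m₁ Wm₂ Wp₂ m₂ : ℕ}
  (hP₁ : ParkOK (kgPark₁ n ℓ h v R' ρ q W N m₁)) (hP₂ : ParkOK (kgPark₂ n ℓ h v R' ρ q W N m₁ Wm₂ Wp₂ m₂))
  (hsplit : (Wm₂ : ℤ) + Wp₂ = (kgPark₁ n ℓ h v R' ρ q W N m₁).aHi (m₁ + 1) - ParkPrm.aLo (kgPark₁ n ℓ h v R' ρ q W N m₁) (m₁ + 1))

include hP₁ hP₂ hsplit in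
/-- **THE SHARP ALONG LOWER BOUND OF THE REGIONS**: every region of the K-G corridor of record lies in the half-plane `y 0 ≥ −(q + R′ + n)` — the back
edge of region `0` — provided `R′ ≤ n` and `q + (N+1)R′ + (m₁+1)(R′+ρ+|v|) + n ≤ (N+1)n` (the parking phases sit ahead of the start).
[cite: KozmaNitzan2024, §4 Lemma 11 (p. 22)] -/
theorem kgCorrSched_region_fst_lower (hnR : R' ≤ n)
    (hrow : (q : ℤ) + (N + 1) * R' + ((m₁ : ℤ) + 1) * (R' + ρ + |v|) + n ≤ ((N : ℤ) + 1) * n)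
    {k : ℕ} (hk : k ≤ (kgCorrSched hP₁ hP₂ hsplit).N) {y : Site 2} (hy : y ∈ (kgCorrSched hP₁ hP₂ hsplit).region k) :
    -((q : ℤ) + R' + n) ≤ y 0 := by
  have hSN : (kgCorrSched hP₁ hP₂ hsplit).N = N + 1 + m₁ + 1 + m₂ := rfl
  have hg₁ : ((kgPark₁ n ℓ h v R' ρ q W N m₁).g : ℤ) = R' + ρ + |v| := by
    rw [ParkPrm.g_eq]; simp [kgPark₁, yParkPrmW]
  have hg0 : (0 : ℤ) ≤ R' + ρ + |v| := by positivity
  have hnR' : (R' : ℤ) ≤ n := by exact_mod_cast hnR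
  rcases kgCorrSched_step_cases (N := N) (m₁ := m₁) (m₂ := m₂) (k := k) (hk.trans_eq hSN) with hkN | ⟨j, hj, rfl⟩ | ⟨j, hj, rfl⟩
  · -- run phase: back edge of region k is `k(n − R′) − q − R′ − n`
    obtain ⟨hreg, -, -⟩ := kgCorrSched_run_view hP₁ hP₂ hsplit hkN
    rw [hreg] at hy
    obtain ⟨h1, -, -, -⟩ := (mem_scheduleN_region_iff (xRunPrmB_ok n ℓ h R' q W N) (xRunPrmB_eb n ℓ h R' q W N)).1 hy
    simp only [RunPrm.aLo, xRunPrmB, xPrmW] at h1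
    have hk0 : (0 : ℤ) ≤ k := by positivity
    have := mul_le_mul_of_nonneg_left hnR' hk0
    linarith
  · -- across-parking phase: transverse (= along the run axis) lower edge `(N+1)n − (q + (N+1)R′) − j·g − R′ − n`
    obtain ⟨hreg, -, -⟩ := kgCorrSched_park₁_view hP₁ hP₂ hsplit hj
    rw [hreg] at hy
    obtain ⟨-, -, h3, -⟩ := (mem_yParkC_region_iff hP₁ (kgC₁ n N)).1 hy
    have hg₁' : ((yParkPrmW n ℓ h v R' ρ (-((kgA₁ n ℓ h R' W N : ℕ) : ℤ)) (kgA₁ n ℓ h R' W N) (q + (N + 1) * R') (q + (N + 1) * R') m₁).g : ℤ) =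
        R' + ρ + |v| := hg₁
    have hc : kgC₁ n N 0 = (((N + 1) * n : ℕ) : ℤ) := by simp [kgC₁]
    simp only [ParkPrm.bLo] at h3
    rw [hg₁', hc] at h3
    simp only [yParkPrmW] at h3
    push_cast at h3
    have hjm : (j : ℤ) * (R' + ρ + |v|) ≤ ((m₁ : ℤ) + 1) * (R' + ρ + |v|) :=
      mul_le_mul_of_nonneg_right (by exact_mod_cast Nat.le_succ_of_le hj) hg0
    linarith
  · -- along-parking phase: along lower edge `(N+1)n + aBot − R′ − n`, `aBot ≥ −X − n`
    obtain ⟨hreg, -, -⟩ := kgCorrSched_park₂_view hP₁ hP₂ hsplit j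
    rw [hreg] at hy
    obtain ⟨h1, -, -, -⟩ := (mem_xParkC_region_iff hP₂ (kgC₂ n ℓ h v R' ρ q W N m₁ Wp₂)).1 hy
    have hbot : (xParkPrmW n ℓ h R' ρ ((kgPark₁ n ℓ h v R' ρ q W N m₁).bLo (m₁ + 1)) ((kgPark₁ n ℓ h v R' ρ q W N m₁).bHi (m₁ + 1)) Wm₂ Wp₂ m₂).aBot ≤
        ParkPrm.aLo (xParkPrmW n ℓ h R' ρ ((kgPark₁ n ℓ h v R' ρ q W N m₁).bLo (m₁ + 1)) ((kgPark₁ n ℓ h v R' ρ q W N m₁).bHi (m₁ + 1)) Wm₂ Wp₂ m₂) j :=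
      ParkPrm.aBot_le_aLo hP₂ j
    have hbLo : (kgPark₁ n ℓ h v R' ρ q W N m₁).bLo (m₁ + 1) = -((q : ℤ) + (N + 1) * R') - ((m₁ : ℤ) + 1) * (R' + ρ + |v|) := by
      simp only [ParkPrm.bLo]; push_cast; rw [hg₁]; simp [kgPark₁, yParkPrmW]
    have hbHi : (kgPark₁ n ℓ h v R' ρ q W N m₁).bHi (m₁ + 1) = (q : ℤ) + (N + 1) * R' + ((m₁ : ℤ) + 1) * (R' + ρ + |v|) := by
      simp only [ParkPrm.bHi]; push_cast; rw [hg₁]; simp [kgPark₁, yParkPrmW]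
    have hbot' : -((q : ℤ) + (N + 1) * R') - ((m₁ : ℤ) + 1) * (R' + ρ + |v|) - n ≤
        (xParkPrmW n ℓ h R' ρ ((kgPark₁ n ℓ h v R' ρ q W N m₁).bLo (m₁ + 1)) ((kgPark₁ n ℓ h v R' ρ q W N m₁).bHi (m₁ + 1)) Wm₂ Wp₂ m₂).aBot := by
      simp only [ParkPrm.aBot, xParkPrmW, hbLo, hbHi]
      rcases le_total (-((q : ℤ) + (N + 1) * R') - ((m₁ : ℤ) + 1) * (R' + ρ + |v|))
          ((q : ℤ) + (N + 1) * R' + ((m₁ : ℤ) + 1) * (R' + ρ + |v|) + 1 - (n : ℕ)) with hc | hc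
      · rw [min_eq_left hc]
        have : (0 : ℤ) ≤ n := by positivity
        linarith
      · rw [min_eq_right hc]
        have : (0 : ℤ) ≤ q := by positivity
        have : (0 : ℤ) ≤ ((N : ℤ) + 1) * R' := by positivity
        have : (0 : ℤ) ≤ ((m₁ : ℤ) + 1) * (R' + ρ + |v|) := by positivity
        linarith
    have hea : ((xParkPrmW n ℓ h R' ρ ((kgPark₁ n ℓ h v R' ρ q W N m₁).bLo (m₁ + 1)) ((kgPark₁ n ℓ h v R' ρ q W N m₁).bHi (m₁ + 1)) Wm₂ Wp₂ m₂).ea : ℤ) =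
        R' := by simp [xParkPrmW]
    have hLa : ((xParkPrmW n ℓ h R' ρ ((kgPark₁ n ℓ h v R' ρ q W N m₁).bLo (m₁ + 1)) ((kgPark₁ n ℓ h v R' ρ q W N m₁).bHi (m₁ + 1)) Wm₂ Wp₂ m₂).La : ℤ) =
        n := by simp [xParkPrmW]
    have hc2 : kgC₂ n ℓ h v R' ρ q W N m₁ Wp₂ 0 = (((N + 1) * n : ℕ) : ℤ) := by simp [kgC₂]
    rw [hea, hLa, hc2] at h1
    push_cast at h1
    linarith

end KG

end Skelφ

end Summit.CriticalPhenomena.PercolationContinuityZ3.Theorems.Transplant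

end
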